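import Mathlib
import Summits.Parity.BatemanHorn.Theorems.IsogenyRedeiTypeIMainTermComponents

/-!
# Crux `PolyMobiusTail` (stmt-Parity-0870), line `Sketch` (natural form): stub `stub_eFun_logpow_summable`

Euler control, with log-power weights, of the `Λ_k`-valued Euler correction `𝓮 = 𝒶 ⋆ ∏ᵢ ψᵢ` of the
Type-I main term: for irreducible, pairwise non-associated `fᵢ` with `ρ_{fᵢ}(p) < p` at every prime,
`Σ_n ‖𝓮(n)‖ (1 + log n)^B < ∞` for every `B : ℕ`.

Proof = the tree's `summable_norm1_eFun` (`B = 0`) with the weight `h(n) = ‖𝓮(n)‖ (1 + log n)^B`: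
`h ≥ 0`, `h(1) = 1`, `h(0) = 0`, and `h` is sub-multiplicative on coprime `m, n > 1`
(`‖𝓮(mn)‖ ≤ ‖𝓮(m)‖ ‖𝓮(n)‖` and `1 + log(mn) ≤ (1 + log m)(1 + log n)`); every local series
`Σ_v h(p^v)` converges (`norm1_eFun_prime_pow_le`, ratio `1 − 1/p`, the weight being
`(1 + v log p)^B ≤ (v+1)^B (1 + log p)^B`); `𝓮(p) = 0`; and at the good primes `p > P₁` the local
tail `Σ_{v ≥ 1} h(p^v)` is `≪ (1 + log p)^{k+1+B}/p²` (`norm1_eFun_prime_pow_le_of_good`), a summable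
majorant (`summable_primes_one_add_log_pow_div_sq`); the Euler-product majorant
`sum_le_prod_tsum_of_submultiplicative` concludes (`eFunLogpow_summable_of_local`).
-/

open scoped BigOperators
open Filter Finset Polynomial Asymptotics

namespace Summit.Parity.BatemanHorn.Theorems.PolyMobiusTail.NaturalForm

open Literature.NumberTheory.Sieve
open Summit.Parity.BatemanHorn.Theorems.TypeIMainTerm

/-- `1 + log (p^v) = 1 + v log p` (naturals cast to `ℝ`). [folklore] -/
theorem eFunLogpow_one_add_log_pow (p v : ℕ) :
    (1 + Real.log ((p ^ v : ℕ) : ℝ)) = 1 + v * Real.log p := by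
  rw [Nat.cast_pow, Real.log_pow]

/-- `(1 + v log p)^m ≤ (v+1)^m (1 + log p)^m` for `log p ≥ 0`. [folklore] -/
theorem eFunLogpow_pow_le {p : ℕ} (hlog : 0 ≤ Real.log p) (v m : ℕ) :
    (1 + v * Real.log p) ^ m ≤ ((v : ℝ) + 1) ^ m * (1 + Real.log p) ^ m := by
  have hv : (0 : ℝ) ≤ v := Nat.cast_nonneg v
  rw [← mul_pow]
  exact pow_le_pow_left₀ (by positivity) (by nlinarith) _

/-- **Abstract Euler-product control.** A nonnegative `h : ℕ → ℝ` with `h 1 = 1`, `h 0 ≤ 1`,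
sub-multiplicative on coprime `m, n > 1`, whose local series `Σ_v h(p^v)` converge at every prime and
whose local tails satisfy `Σ_{v ≥ 1} h(p^v) ≤ c (1 + log p)^m / p²` for the primes `p > P₁`, is
summable: `Σ_{n ≤ X} h(n) ≤ ∏_{p ≤ X} (1 + w_p) ≤ exp (Σ_{p ≤ P₁} w_p + c Σ_p (1 + log p)^m/p²)`
(`sum_le_prod_tsum_of_submultiplicative`, `summable_primes_one_add_log_pow_div_sq`). [folklore] -/
theorem eFunLogpow_summable_of_local (h : ℕ → ℝ) (h0 : ∀ n, 0 ≤ h n) (h1 : h 1 = 1)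
    (h00 : h 0 ≤ 1)
    (hsub : ∀ m n, 1 < m → 1 < n → Nat.Coprime m n → h (m * n) ≤ h m * h n)
    (hloc : ∀ p, p.Prime → Summable (fun v => h (p ^ v))) {P₁ m : ℕ} {c : ℝ} (hc0 : 0 ≤ c)
    (htail : ∀ p : ℕ, p.Prime → P₁ < p →
      ∑' v : ℕ, h (p ^ (v + 1)) ≤ c * ((1 + Real.log p) ^ m / (p : ℝ) ^ 2)) :
    Summable h := by
  -- the local tails `w_p = ∑_{v ≥ 1} h(p^v)`
  set w : ℕ → ℝ := fun p => ∑' v : ℕ, h (p ^ (v + 1)) with hw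
  have hw0 : ∀ p, 0 ≤ w p := fun p => tsum_nonneg fun v => h0 _
  have hlocal : ∀ p : ℕ, p.Prime → ∑' v, h (p ^ v) = 1 + w p := by
    intro p hp
    rw [(hloc p hp).tsum_eq_zero_add, pow_zero, h1]
  -- the summable majorant over primes
  have hsumm : Summable (fun p : Nat.Primes => c * ((1 + Real.log p) ^ m / ((p : ℕ) : ℝ) ^ 2)) :=
    (summable_primes_one_add_log_pow_div_sq m).mul_left c
  set T : ℝ := ∑' p : Nat.Primes, c * ((1 + Real.log p) ^ m / ((p : ℕ) : ℝ) ^ 2) with hT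
  set W : ℝ := ∑ p ∈ Nat.primesLE P₁, w p + T with hW
  -- `∑_{p ≤ X} w_p ≤ W`
  have hWX : ∀ X : ℕ, ∑ p ∈ Nat.primesLE X, w p ≤ W := by
    intro X
    rw [← Finset.sum_filter_add_sum_filter_not (Nat.primesLE X) (fun p => p ≤ P₁)]
    refine add_le_add ?_ ?_
    · refine Finset.sum_le_sum_of_subset_of_nonneg (fun p hp => ?_) fun p _ _ => hw0 p
      rw [Finset.mem_filter, Nat.mem_primesLE] at hp
      exact Nat.mem_primesLE.mpr ⟨hp.2, hp.1.2⟩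
    · calc ∑ p ∈ (Nat.primesLE X).filter (fun p => ¬p ≤ P₁), w p
          ≤ ∑ p ∈ (Nat.primesLE X).filter (fun p => ¬p ≤ P₁),
              c * ((1 + Real.log p) ^ m / (p : ℝ) ^ 2) := by
            refine Finset.sum_le_sum fun p hp => ?_
            rw [Finset.mem_filter, Nat.mem_primesLE, not_le] at hp
            exact htail p hp.1.2 hp.2
        _ ≤ ∑ p ∈ Nat.primesLE X, c * ((1 + Real.log p) ^ m / (p : ℝ) ^ 2) :=
            Finset.sum_le_sum_of_subset_of_nonneg (Finset.filter_subset _ _) fun p _ _ => by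
              have := Real.log_natCast_nonneg p
              positivity
        _ ≤ T := sum_primesLE_le_tsum_primes
            (g := fun p => c * ((1 + Real.log p) ^ m / (p : ℝ) ^ 2))
            (fun p => by
              have := Real.log_natCast_nonneg p
              positivity) hsumm X
  -- bounded partial sums
  have hpartial : ∀ X : ℕ, ∑ n ∈ Icc 1 X, h n ≤ Real.exp W := by
    intro X
    refine (sum_le_prod_tsum_of_submultiplicative h h0 h1 h00 hsub hloc X).trans ?_
    calc ∏ p ∈ Nat.primesLE X, ∑' v, h (p ^ v) = ∏ p ∈ Nat.primesLE X, (1 + w p) :=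
          Finset.prod_congr rfl fun p hp => hlocal p (Nat.prime_of_mem_primesLE hp)
      _ ≤ ∏ p ∈ Nat.primesLE X, Real.exp (w p) :=
          Finset.prod_le_prod (fun p _ => by linarith [hw0 p]) fun p _ => by
            linarith [Real.add_one_le_exp (w p)]
      _ = Real.exp (∑ p ∈ Nat.primesLE X, w p) := by rw [Real.exp_sum]
      _ ≤ Real.exp W := Real.exp_le_exp.mpr (hWX X)
  -- conclude
  have hrange : ∀ N : ℕ, ∑ n ∈ Finset.range N, h n ≤ 1 + Real.exp W := by
    intro N
    have hsub' : Finset.range N ⊆ insert 0 (Icc 1 N) := by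
      intro n hn
      rw [Finset.mem_insert, Finset.mem_Icc]; rw [Finset.mem_range] at hn; omega
    calc ∑ n ∈ Finset.range N, h n ≤ ∑ n ∈ insert 0 (Icc 1 N), h n :=
          Finset.sum_le_sum_of_subset_of_nonneg hsub' fun n _ _ => h0 n
      _ = h 0 + ∑ n ∈ Icc 1 N, h n := Finset.sum_insert (by simp)
      _ ≤ 1 + Real.exp W := add_le_add h00 (hpartial N)
  exact summable_of_sum_range_le h0 hrange

variable {k : ℕ} (f : Fin k → ℤ[X])

/-- **Every local series `Σ_v ‖𝓮(p^v)‖ (1 + log p^v)^B` converges**: by `norm1_eFun_prime_pow_le`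
with `γ = 1 − 1/p < 1`, `‖𝓮(p^v)‖ (1 + v log p)^B ≤ C (v+1)^{4k+B} γ^v`. [folklore] -/
theorem eFunLogpow_summable_prime_pow (hρ : ∀ i p, p.Prime → polyRootCountMod ![f i] p < p)
    {p : ℕ} (hp : p.Prime) (B : ℕ) :
    Summable (fun v : ℕ => SAlg.norm1 (eFun f (p ^ v)) * (1 + Real.log ((p ^ v : ℕ) : ℝ)) ^ B) := by
  set γ : ℝ := 1 - 1 / (p : ℝ) with hγ
  have hp2 : (2 : ℝ) ≤ p := by exact_mod_cast hp.two_le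
  have hp0 : (0 : ℝ) < p := by linarith
  have hγ0 : 0 < γ := by
    rw [hγ, sub_pos, div_lt_one hp0]; linarith
  have hγ1 : γ < 1 := by
    have : 0 < 1 / (p : ℝ) := by positivity
    simp only [hγ]; linarith
  have hγi : ∀ i, rootDensity (f i) p ≤ γ := fun i => rootDensity_le_one_sub_inv f hp (hρ i p hp)
  have hlog : 0 ≤ Real.log p := Real.log_nonneg (by linarith)
  set C : ℝ := ((k : ℝ) + 1) * (1 + Real.log p) ^ (2 * k + B) * (γ⁻¹) ^ k with hC
  refine Summable.of_nonneg_of_le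
    (fun v => mul_nonneg (SAlg.norm1_nonneg _) (pow_nonneg (by
      have := Real.log_natCast_nonneg (p ^ v); linarith) _))
    (fun v => ?_)
    ((Literature.Analysis.ODE.summable_succ_pow_mul_geometric (4 * k + B) hγ0.le hγ1).mul_left C)
  rw [eFunLogpow_one_add_log_pow]
  refine (mul_le_mul_of_nonneg_right (norm1_eFun_prime_pow_le f hp hγ0.le hγ1.le hγi v)
    (by positivity)).trans ?_
  -- `(k+1)(v+1)^{2k}(1 + v log p)^{2k} γ^{v-k} (1 + v log p)^B ≤ C (v+1)^{4k+B} γ^v`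
  have h1 : (1 + v * Real.log p) ^ (2 * k + B) ≤
      ((v : ℝ) + 1) ^ (2 * k + B) * (1 + Real.log p) ^ (2 * k + B) := eFunLogpow_pow_le hlog v _
  have h2 : γ ^ (v - k) ≤ γ ^ v * (γ⁻¹) ^ k := by
    rw [inv_pow, ← div_eq_mul_inv, le_div_iff₀ (pow_pos hγ0 k)]
    rcases le_or_gt k v with hkv | hkv
    · rw [← pow_add, Nat.sub_add_cancel hkv]
    · rw [Nat.sub_eq_zero_of_le hkv.le, pow_zero, one_mul]
      exact pow_le_pow_of_le_one hγ0.le hγ1.le hkv.le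
  calc ((k : ℝ) + 1) * (((v : ℝ) + 1) ^ (2 * k) * (1 + v * Real.log p) ^ (2 * k) * γ ^ (v - k)) *
        (1 + v * Real.log p) ^ B
      = ((k : ℝ) + 1) * (((v : ℝ) + 1) ^ (2 * k) * (1 + v * Real.log p) ^ (2 * k + B) *
          γ ^ (v - k)) := by ring
    _ ≤ ((k : ℝ) + 1) * (((v : ℝ) + 1) ^ (2 * k) *
          (((v : ℝ) + 1) ^ (2 * k + B) * (1 + Real.log p) ^ (2 * k + B)) * (γ ^ v * (γ⁻¹) ^ k)) := by
        gcongr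
    _ = C * (((v : ℝ) + 1) ^ (4 * k + B) * γ ^ v) := by rw [hC]; ring

/-- **The local tail at a good prime `p ≥ 2R`** (no two `fᵢ` with a common root mod `p`,
`ρ_{fᵢ}(p) ≤ R`): since `𝓮(p) = 0` and, for `v ≥ 2`,
`‖𝓮(p^v)‖ ≤ (k+1)(v+1)^k (1 + v log p)^{k+1} (R/p)^v` (`norm1_eFun_prime_pow_le_of_good`) with
`R/p ≤ 1/2`, one gets `Σ_{v ≥ 1} ‖𝓮(p^v)‖ (1 + log p^v)^B ≤ (k+1) M R² (1 + log p)^{k+1+B} / p²`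
with `M = Σ_u (u+3)^{2k+1+B} 2^{-u}`. [folklore] -/
theorem eFunLogpow_tsum_prime_pow_le_of_good (hρ : ∀ i p, p.Prime → polyRootCountMod ![f i] p < p)
    {R : ℝ} (hR0 : 0 ≤ R) (hR : ∀ i p, p.Prime → (polyRootCountMod ![f i] p : ℝ) ≤ R) {p : ℕ}
    (hp : p.Prime)
    (hgood : ∀ i i' : Fin k, i ≠ i' → ∀ n : ℕ,
      ¬(((p : ℕ) : ℤ) ∣ (f i).eval (n : ℤ) ∧ ((p : ℕ) : ℤ) ∣ (f i').eval (n : ℤ)))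
    (hpR : 2 * R ≤ p) (B : ℕ) :
    ∑' v : ℕ, SAlg.norm1 (eFun f (p ^ (v + 1))) * (1 + Real.log ((p ^ (v + 1) : ℕ) : ℝ)) ^ B ≤
      ((k : ℝ) + 1) * (∑' u : ℕ, ((u : ℝ) + 3) ^ (2 * k + 1 + B) * (1 / 2 : ℝ) ^ u) * R ^ 2 *
        ((1 + Real.log p) ^ (k + 1 + B) / (p : ℝ) ^ 2) := by
  have hsum := eFunLogpow_summable_prime_pow f hρ hp B
  have hp2 : (2 : ℝ) ≤ p := by exact_mod_cast hp.two_le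
  have hp0 : (0 : ℝ) < p := by linarith
  have hlog : 0 ≤ Real.log p := Real.log_nonneg (by linarith)
  set γ : ℝ := R / p with hγ
  have hγ0 : 0 ≤ γ := by positivity
  have hγi : ∀ i, rootDensity (f i) p ≤ γ := fun i => by
    rw [rootDensity_apply, hγ]; exact div_le_div_of_nonneg_right (hR i p hp) hp0.le
  have hγhalf : γ ≤ 1 / 2 := by
    rw [hγ, div_le_iff₀ hp0]; linarith
  -- the polynomial–geometric constant
  set Mk : ℝ := ∑' u : ℕ, ((u : ℝ) + 3) ^ (2 * k + 1 + B) * (1 / 2 : ℝ) ^ u with hMk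
  have hMs : Summable (fun u : ℕ => ((u : ℝ) + 3) ^ (2 * k + 1 + B) * (1 / 2 : ℝ) ^ u) := by
    have h3 := (Literature.Analysis.ODE.summable_succ_pow_mul_geometric (2 * k + 1 + B)
      (by norm_num : (0:ℝ) ≤ 1 / 2) (by norm_num)).mul_left ((3 : ℝ) ^ (2 * k + 1 + B))
    refine Summable.of_nonneg_of_le (fun u => by positivity) (fun u => ?_) h3
    rw [← mul_assoc, ← mul_pow]
    gcongr
    linarith
  -- drop the vanishing term `v = 0` (`𝓮(p) = 0`)
  have hg : Summable (fun v : ℕ =>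
      SAlg.norm1 (eFun f (p ^ (v + 1))) * (1 + Real.log ((p ^ (v + 1) : ℕ) : ℝ)) ^ B) :=
    (summable_nat_add_iff (f := fun v : ℕ =>
      SAlg.norm1 (eFun f (p ^ v)) * (1 + Real.log ((p ^ v : ℕ) : ℝ)) ^ B) 1).mpr hsum
  have hshift : Summable (fun v : ℕ =>
      SAlg.norm1 (eFun f (p ^ (v + 1 + 1))) * (1 + Real.log ((p ^ (v + 1 + 1) : ℕ) : ℝ)) ^ B) :=
    (summable_nat_add_iff (f := fun v : ℕ =>
      SAlg.norm1 (eFun f (p ^ (v + 1))) * (1 + Real.log ((p ^ (v + 1) : ℕ) : ℝ)) ^ B) 1).mpr hg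
  have hg1 : SAlg.norm1 (eFun f (p ^ (0 + 1))) * (1 + Real.log ((p ^ (0 + 1) : ℕ) : ℝ)) ^ B = 0 := by
    rw [zero_add, pow_one, eFun_prime f hp, SAlg.norm1_zero, zero_mul]
  rw [hg.tsum_eq_zero_add, hg1, zero_add]
  -- the majorant for `v ≥ 2`
  have hmaj : ∀ v : ℕ,
      SAlg.norm1 (eFun f (p ^ (v + 1 + 1))) * (1 + Real.log ((p ^ (v + 1 + 1) : ℕ) : ℝ)) ^ B ≤
        ((k : ℝ) + 1) * (1 + Real.log p) ^ (k + 1 + B) * γ ^ 2 *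
          (((v : ℝ) + 3) ^ (2 * k + 1 + B) * (1 / 2 : ℝ) ^ v) := by
    intro v
    rw [eFunLogpow_one_add_log_pow]
    have hw0 : 0 ≤ (1 + ((v + 1 + 1 : ℕ) : ℝ) * Real.log p) ^ B := by positivity
    refine (mul_le_mul_of_nonneg_right
      (norm1_eFun_prime_pow_le_of_good f hp hgood hγ0 hγi (v := v + 1 + 1) (by omega)) hw0).trans ?_
    have e1 : ((v + 1 + 1 : ℕ) : ℝ) = v + 2 := by push_cast; ring
    rw [e1]
    have h1 : (1 + ((v : ℝ) + 2) * Real.log p) ^ (k + 1 + B) ≤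
        ((v : ℝ) + 3) ^ (k + 1 + B) * (1 + Real.log p) ^ (k + 1 + B) := by
      rw [← mul_pow]; exact pow_le_pow_left₀ (by positivity) (by nlinarith) _
    have h2 : γ ^ (v + 2) ≤ γ ^ 2 * (1 / 2 : ℝ) ^ v := by
      rw [show v + 2 = 2 + v by ring, pow_add]
      exact mul_le_mul_of_nonneg_left (pow_le_pow_left₀ hγ0 hγhalf v) (by positivity)
    have h3 : ((v : ℝ) + 2 + 1) ^ k = ((v : ℝ) + 3) ^ k := by ring
    calc ((k : ℝ) + 1) * (((v : ℝ) + 2 + 1) ^ k * (1 + ((v : ℝ) + 2) * Real.log p) ^ (k + 1) *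
          γ ^ (v + 2)) * (1 + ((v : ℝ) + 2) * Real.log p) ^ B
        = ((k : ℝ) + 1) * (((v : ℝ) + 3) ^ k * (1 + ((v : ℝ) + 2) * Real.log p) ^ (k + 1 + B) *
            γ ^ (v + 2)) := by rw [h3]; ring
      _ ≤ ((k : ℝ) + 1) * (((v : ℝ) + 3) ^ k *
            (((v : ℝ) + 3) ^ (k + 1 + B) * (1 + Real.log p) ^ (k + 1 + B)) *
            (γ ^ 2 * (1 / 2 : ℝ) ^ v)) := by gcongr
      _ = ((k : ℝ) + 1) * (1 + Real.log p) ^ (k + 1 + B) * γ ^ 2 *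
            (((v : ℝ) + 3) ^ (2 * k + 1 + B) * (1 / 2 : ℝ) ^ v) := by ring
  calc ∑' v : ℕ, SAlg.norm1 (eFun f (p ^ (v + 1 + 1))) * (1 + Real.log ((p ^ (v + 1 + 1) : ℕ) : ℝ)) ^ B
      ≤ ∑' v : ℕ, ((k : ℝ) + 1) * (1 + Real.log p) ^ (k + 1 + B) * γ ^ 2 *
          (((v : ℝ) + 3) ^ (2 * k + 1 + B) * (1 / 2 : ℝ) ^ v) :=
        Summable.tsum_le_tsum hmaj hshift (hMs.mul_left _)
    _ = ((k : ℝ) + 1) * Mk * R ^ 2 * ((1 + Real.log p) ^ (k + 1 + B) / (p : ℝ) ^ 2) := by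
        rw [tsum_mul_left, ← hMk, hγ, div_pow]
        field_simp

/-- **Stub `stub_eFun_logpow_summable`.** For irreducible, pairwise non-associated `fᵢ` with
`ρ_{fᵢ}(p) < p` at every prime: `Σ_n ‖𝓮(n)‖ (1 + log n)^B < ∞` for every `B` — the proof of the
tree's `summable_norm1_eFun` (`B = 0`) with the sub-multiplicative weight `(1 + log n)^B`: at every
prime the local series still converges (`eFunLogpow_summable_prime_pow`), `𝓮(p) = 0`, and at the good
primes the tail is `≪ (1 + log p)^{k+1+B}/p²` (`eFunLogpow_tsum_prime_pow_le_of_good`); conclude with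
`eFunLogpow_summable_of_local`. [folklore] -/
theorem stub_eFun_logpow_summable : ∀ (k : ℕ) (f : Fin k → ℤ[X]),
    (∀ i, Irreducible (f i)) → (Pairwise fun i j => ¬Associated (f i) (f j)) →
    (∀ i p, p.Prime → Literature.NumberTheory.Sieve.polyRootCountMod ![f i] p < p) → ∀ B : ℕ,
    Summable (fun n : ℕ => Summit.Parity.BatemanHorn.Theorems.TypeIMainTerm.SAlg.norm1 (Summit.Parity.BatemanHorn.Theorems.TypeIMainTerm.eFun f n) * (1 + Real.log n) ^ B) := by
  intro k f hirr hna hρ B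
  -- a common bound `ρ_{f_i}(p) ≤ R`
  have hRi : ∀ i, ∃ R : ℝ, 1 ≤ R ∧ ∀ p : ℕ, p.Prime → (polyRootCountMod ![f i] p : ℝ) ≤ R :=
    fun i => exists_rootCount_prime_le (hirr i).ne_zero
  choose Ri hRi1 hRi using hRi
  set R : ℝ := 1 + ∑ i, Ri i with hRdef
  have hR0 : 0 ≤ R := by
    have : 0 ≤ ∑ i, Ri i := Finset.sum_nonneg fun i _ => by linarith [hRi1 i]
    linarith
  have hR : ∀ i p, p.Prime → (polyRootCountMod ![f i] p : ℝ) ≤ R := by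
    intro i p hp
    refine (hRi i p hp).trans ?_
    have : Ri i ≤ ∑ j, Ri j :=
      Finset.single_le_sum (fun j _ => by linarith [hRi1 j]) (Finset.mem_univ i)
    linarith
  -- the good primes `p > P₁`
  obtain ⟨P₀, hP₀⟩ := exists_forall_not_dvd_eval_and_dvd_eval hirr hna
  have hM0 : 0 ≤ ∑' u : ℕ, ((u : ℝ) + 3) ^ (2 * k + 1 + B) * (1 / 2 : ℝ) ^ u :=
    tsum_nonneg fun u => by positivity
  have hc0 : 0 ≤ ((k : ℝ) + 1) * (∑' u : ℕ, ((u : ℝ) + 3) ^ (2 * k + 1 + B) * (1 / 2 : ℝ) ^ u) *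
      R ^ 2 := mul_nonneg (mul_nonneg (by positivity) hM0) (sq_nonneg R)
  refine eFunLogpow_summable_of_local
    (fun n : ℕ => SAlg.norm1 (eFun f n) * (1 + Real.log n) ^ B)
    (fun n => mul_nonneg (SAlg.norm1_nonneg _) (pow_nonneg (by
      have := Real.log_natCast_nonneg n; linarith) _))
    (by simp only [Nat.cast_one, Real.log_one, add_zero, one_pow, mul_one]; exact norm1_eFun_one f)
    (by simp only [ArithmeticFunction.map_zero, SAlg.norm1_zero, zero_mul]; norm_num)
    (fun m n hm hn hmn => ?_) (fun p hp => eFunLogpow_summable_prime_pow f hρ hp B)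
    (P₁ := max P₀ ⌈2 * R⌉₊) (m := k + 1 + B) hc0 (fun p hp hpP => ?_)
  · -- sub-multiplicativity on coprime `m, n > 1`
    show SAlg.norm1 (eFun f (m * n)) * (1 + Real.log ((m * n : ℕ) : ℝ)) ^ B ≤
      SAlg.norm1 (eFun f m) * (1 + Real.log (m : ℝ)) ^ B *
        (SAlg.norm1 (eFun f n) * (1 + Real.log (n : ℝ)) ^ B)
    rw [(isMultiplicative_eFun f).map_mul_of_coprime hmn]
    have hm0 : (m : ℝ) ≠ 0 := by exact_mod_cast (by omega : m ≠ 0)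
    have hn0 : (n : ℝ) ≠ 0 := by exact_mod_cast (by omega : n ≠ 0)
    have hlm : 0 ≤ Real.log (m : ℝ) := Real.log_natCast_nonneg m
    have hln : 0 ≤ Real.log (n : ℝ) := Real.log_natCast_nonneg n
    have hw : (1 + Real.log ((m * n : ℕ) : ℝ)) ^ B ≤
        (1 + Real.log (m : ℝ)) ^ B * (1 + Real.log (n : ℝ)) ^ B := by
      rw [← mul_pow, Nat.cast_mul, Real.log_mul hm0 hn0]
      exact pow_le_pow_left₀ (by linarith) (by nlinarith [mul_nonneg hlm hln]) _
    calc SAlg.norm1 (eFun f m * eFun f n) * (1 + Real.log ((m * n : ℕ) : ℝ)) ^ B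
        ≤ SAlg.norm1 (eFun f m) * SAlg.norm1 (eFun f n) *
            ((1 + Real.log (m : ℝ)) ^ B * (1 + Real.log (n : ℝ)) ^ B) :=
          mul_le_mul (SAlg.norm1_mul_le _ _) hw (pow_nonneg (by
            have := Real.log_natCast_nonneg (m * n); linarith) _)
            (mul_nonneg (SAlg.norm1_nonneg _) (SAlg.norm1_nonneg _))
      _ = _ := by ring
  · -- the local tail at a good prime `p > P₁`
    have hgood : ∀ i i' : Fin k, i ≠ i' → ∀ n : ℕ,
        ¬(((p : ℕ) : ℤ) ∣ (f i).eval (n : ℤ) ∧ ((p : ℕ) : ℤ) ∣ (f i').eval (n : ℤ)) :=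
      fun i i' hii' n => hP₀ p (lt_of_le_of_lt (le_max_left _ _) hpP) i i' hii' (n : ℤ)
    have hpR : 2 * R ≤ p := by
      have h2 : (⌈2 * R⌉₊ : ℝ) ≤ p := by exact_mod_cast ((le_max_right _ _).trans hpP.le)
      exact (Nat.le_ceil _).trans h2
    exact eFunLogpow_tsum_prime_pow_le_of_good f hρ hR0 hR hp hgood hpR B

end Summit.Parity.BatemanHorn.Theorems.PolyMobiusTail.NaturalForm
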